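import Summits.AtomisticToContinuum.HydrodynamicLimit.Theorems.SpeedCapSurgeryEquilibriumMaxSpeed
import Summits.AtomisticToContinuum.HydrodynamicLimit.Theorems.SpeedCapSurgeryMaxSpeedBoundLogNonStationaryFlux

/-!
# Pre-shock variant of the birth line — crux `MaxSpeedBoundLog` (stmt-AtomisticToContinuum-9629)

Lead c1 (prover-line-stmt-AtomisticToContinuum-9629-c1-0, 2026-08-17). NOT a registered skeleton and
NOT a route item: a kernel-checked certificate, for the tenure / route-repair planner, that the
registered line `registered` (= `Cruxes/MaxSpeedBoundLog/Lines/birth.lean`) transfers VERBATIM to the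
recommended restatement of the crux in the pre-shock frame — the only frame in which the route's
deciding theorem `closes` consumes it (`t ∈ Ico 0 T` along a classical hard-sphere Euler solution
matched by the local-Gibbs LLN at `t = 0`; recommended by refuter rreview-0815T14-2-0 14:48Z 08-15,
rreview-g3 16:04Z 08-15, eread 07:41Z / 10:13Z 08-17, crux-strategist s2 10:16Z 08-17, and this lead).

Two candidate restatements are certified, the planner picks one:

* `MaxSpeedBoundLogPreShock` — the strategist's / refuter's text (`StrategistSketch.lean`,
  `W_Speed2.lean`): classical Euler solution on `[0,T)`, LLN at `0`, cap for `t ∈ Ico 0 T`;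
* `MaxSpeedBoundLogPreShockGuarded` — the same WITH the conjunct's packing guard
  (`∃ η₀ > 0` outermost; only solutions with `ρ_t(x) σ³ < η₀` on `[0,T) × 𝕋³`), i.e. exactly the
  hypotheses under which `closes` invokes the crux since the 2026-08-16 re-type of the conjunct
  (p126922) — the WEAKEST form the assembly consumes (recommended).

For each: (i) nothing is lost (`…_of_maxSpeedBoundLog`: the crux as typed implies it);
(ii) the route still closes (`closes_preShock`, `closes_preShockGuarded`: same script as `closes`);
(iii) the line transfers: the restated dynamic stub `EnergeticCollisionsRarePreShock[Guarded]`
(stub 3 with the same prefix) gives the restated crux through the LANDED pieces of the line —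
`stub_initialSpeedTailLog` (p148064), `stub_energeticCollisionRecord` (p147642) and the composition
`exists_speedCap_of` (p149684) — `MaxSpeedBoundLogPreShock[Guarded]_of`; (iv) the restated stub is
implied by the registered one (`…_of_allTime`), so the conditional results landed in cycle 1
(`energeticCollisionsRare_of` p149442: stub 3 from `GaussianVelocityTails ∧
ContactIntensityDominationOneRare`) carry over unchanged.

After the cycle-2 RESHAPE of the registered skeleton (stub 3 = 3a + 3b; 3a
`stub_energeticCollisionsRare_of_windowBound` LANDED p155909; 3b `stub_energeticWindowBound` open,
calibrated at constant profiles p156882) the same holds one level down: the restated open stub is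
`EnergeticWindowBoundPreShockGuarded` (3b with the pre-shock guarded prefix, `t ∈ Ioo 0 T`), it is
implied by the registered 3b (`…_of_allTime`), and it gives the restated stub 3 through the LANDED
3a (`energeticCollisionsRarePreShockGuarded_of_window`), hence the restated crux
(`MaxSpeedBoundLogPreShockGuarded_of_window`).

`lean check`: rc 0, 0 sorry, 0 warnings expected; nothing here is proposed to the gate.
-/

namespace Summit.AtomisticToContinuum.HydrodynamicLimit.Cruxes.MaxSpeedBoundLog.BirthPreShock

open MeasureTheory Filter Set Topology
open scoped ENNReal
open Literature.MathematicalPhysics.KineticTheory Literature.Analysis.FluidPDE Literature.Analysis.FunctionSpaces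
open Summit.AtomisticToContinuum.HydrodynamicLimit.Theses.SpeedCapSurgery
open Summit.AtomisticToContinuum.HydrodynamicLimit.Theorems.MaxSpeedBoundLogLine

/-! ## The two candidate restatements of the crux -/

/-- PRE-SHOCK form of the crux (strategist / refuter text, re-typed verbatim): the `C√log(N+2)` cap
asserted only for `t ∈ [0,T)` along a classical hard-sphere Euler solution on `[0,T)` matched by
the local-Gibbs LLN at `t = 0`. -/
def MaxSpeedBoundLogPreShock : Prop :=
  ∀ (a₀ θ₀ : T3 → ℝ) (u₀ : T3 → V3), Continuous a₀ → Continuous θ₀ → Continuous u₀ →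
    (∀ x, 0 < a₀ x) → (∀ x, 0 < θ₀ x) →
    ∃ σ₀ : ℝ, 0 < σ₀ ∧ ∀ σ : ℝ, 0 < σ → σ < σ₀ →
      ∀ (T : ℝ) (ρ θ : ℝ → T3 → ℝ) (u : ℝ → T3 → V3), IsHardSphereEulerSolution σ T ρ u θ →
        ∀ Φ : (N : ℕ) → HardSphereFlow (Torus.geometry (Fin 3)) (hsDiameter σ N) (N + 1),
          TendstoHydroFieldsAt (fun N => localGibbsLaw σ a₀ u₀ θ₀ N (Φ N)) Φ ρ u θ 0 →
            ∀ t ∈ Ico 0 T, ∃ C : ℝ,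
              Tendsto (fun N : ℕ => localGibbsLaw σ a₀ u₀ θ₀ N (Φ N)
                {z | ∃ r ∈ Icc 0 t, ∃ i, C * Real.sqrt (Real.log ((N : ℝ) + 2)) < ‖((Φ N).flow r z i).2‖})
                atTop (𝓝 0)

/-- PRE-SHOCK, PACKING-GUARDED form of the crux (recommended): as `MaxSpeedBoundLogPreShock`, with
the conjunct's packing guard — `∃ η₀ > 0` outermost and only Euler solutions with
`ρ_t(x) σ³ < η₀` on `[0,T) × 𝕋³` — exactly the hypotheses under which `closes` invokes the crux. -/
def MaxSpeedBoundLogPreShockGuarded : Prop :=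
  ∃ η₀ : ℝ, 0 < η₀ ∧ ∀ (a₀ θ₀ : T3 → ℝ) (u₀ : T3 → V3), Continuous a₀ → Continuous θ₀ → Continuous u₀ →
    (∀ x, 0 < a₀ x) → (∀ x, 0 < θ₀ x) →
    ∃ σ₀ : ℝ, 0 < σ₀ ∧ ∀ σ : ℝ, 0 < σ → σ < σ₀ →
      ∀ (T : ℝ) (ρ θ : ℝ → T3 → ℝ) (u : ℝ → T3 → V3), IsHardSphereEulerSolution σ T ρ u θ →
        (∀ t ∈ Ico 0 T, ∀ x, ρ t x * σ ^ 3 < η₀) →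
        ∀ Φ : (N : ℕ) → HardSphereFlow (Torus.geometry (Fin 3)) (hsDiameter σ N) (N + 1),
          TendstoHydroFieldsAt (fun N => localGibbsLaw σ a₀ u₀ θ₀ N (Φ N)) Φ ρ u θ 0 →
            ∀ t ∈ Ico 0 T, ∃ C : ℝ,
              Tendsto (fun N : ℕ => localGibbsLaw σ a₀ u₀ θ₀ N (Φ N)
                {z | ∃ r ∈ Icc 0 t, ∃ i, C * Real.sqrt (Real.log ((N : ℝ) + 2)) < ‖((Φ N).flow r z i).2‖})
                atTop (𝓝 0)

/-- Nothing is lost (1): the crux as typed implies its pre-shock form. -/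
theorem preShock_of_maxSpeedBoundLog (h : MaxSpeedBoundLog) : MaxSpeedBoundLogPreShock := by
  intro a₀ θ₀ u₀ ha hθ hu ha0 hθ0
  obtain ⟨σ₀, hσ₀, H⟩ := h a₀ θ₀ u₀ ha hθ hu ha0 hθ0
  exact ⟨σ₀, hσ₀, fun σ hσ hσ' T ρ θ u _ Φ _ t ht => H σ hσ hσ' t ht.1 Φ⟩

/-- Nothing is lost (2): the pre-shock form implies the guarded pre-shock form (any `η₀`, e.g. `1`). -/
theorem preShockGuarded_of_preShock (h : MaxSpeedBoundLogPreShock) : MaxSpeedBoundLogPreShockGuarded := by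
  refine ⟨1, one_pos, fun a₀ θ₀ u₀ ha hθ hu ha0 hθ0 => ?_⟩
  obtain ⟨σ₀, hσ₀, H⟩ := h a₀ θ₀ u₀ ha hθ hu ha0 hθ0
  exact ⟨σ₀, hσ₀, fun σ hσ hσ' T ρ θ u hsol _ Φ h0 t ht => H σ hσ hσ' T ρ θ u hsol Φ h0 t ht⟩

/-- Nothing is lost (3): the crux as typed implies the guarded pre-shock form. -/
theorem preShockGuarded_of_maxSpeedBoundLog (h : MaxSpeedBoundLog) : MaxSpeedBoundLogPreShockGuarded :=
  preShockGuarded_of_preShock (preShock_of_maxSpeedBoundLog h)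

/-! ## The route still closes -/

/-- The squeeze of `closes`, isolated: at fixed `(σ, t, Φ, C)`, if the cap event has probability
`→ 0` then every event family whose restricted probability `→ 0` has probability `→ 0`. -/
theorem tendsto_of_tendsto_restrict_cap {σ : ℝ} {a₀ θ₀ : T3 → ℝ} {u₀ : T3 → V3} {t C : ℝ}
    {Φ : (N : ℕ) → HardSphereFlow (Torus.geometry (Fin 3)) (hsDiameter σ N) (N + 1)}
    (hC : Tendsto (fun N : ℕ => localGibbsLaw σ a₀ u₀ θ₀ N (Φ N)
      {z | ∃ r ∈ Icc 0 t, ∃ i, C * Real.sqrt (Real.log ((N : ℝ) + 2)) < ‖((Φ N).flow r z i).2‖})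
      atTop (𝓝 0))
    (A : (N : ℕ) → Set (Config (N + 1) (Fin 3) T3))
    (hA : Tendsto (fun N : ℕ => (localGibbsLaw σ a₀ u₀ θ₀ N (Φ N)).restrict
        {z | ∀ r ∈ Icc 0 t, ∀ i, ‖((Φ N).flow r z i).2‖ ≤ C * Real.sqrt (Real.log ((N : ℝ) + 2))} (A N))
        atTop (𝓝 0)) :
    Tendsto (fun N : ℕ => localGibbsLaw σ a₀ u₀ θ₀ N (Φ N) (A N)) atTop (𝓝 0) := by
  have hsum := hA.add hC
  rw [add_zero] at hsum
  refine tendsto_of_tendsto_of_tendsto_of_le_of_le tendsto_const_nhds hsum (fun _ => zero_le) fun N => ?_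
  set cap : Set (Config (N + 1) (Fin 3) T3) :=
    {z | ∀ r ∈ Icc 0 t, ∀ i, ‖((Φ N).flow r z i).2‖ ≤ C * Real.sqrt (Real.log ((N : ℝ) + 2))} with hcap
  calc localGibbsLaw σ a₀ u₀ θ₀ N (Φ N) (A N)
      ≤ localGibbsLaw σ a₀ u₀ θ₀ N (Φ N) (A N ∩ cap ∪ A N \ cap) := by
        refine measure_mono fun z hz => ?_
        by_cases hzs : z ∈ cap
        · exact Or.inl ⟨hz, hzs⟩
        · exact Or.inr ⟨hz, hzs⟩
    _ ≤ localGibbsLaw σ a₀ u₀ θ₀ N (Φ N) (A N ∩ cap) + localGibbsLaw σ a₀ u₀ θ₀ N (Φ N) (A N \ cap) :=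
        measure_union_le _ _
    _ ≤ (localGibbsLaw σ a₀ u₀ θ₀ N (Φ N)).restrict cap (A N) +
        localGibbsLaw σ a₀ u₀ θ₀ N (Φ N)
          {z | ∃ r ∈ Icc 0 t, ∃ i, C * Real.sqrt (Real.log ((N : ℝ) + 2)) < ‖((Φ N).flow r z i).2‖} := by
        refine add_le_add (Measure.le_restrict_apply _ _) (measure_mono ?_)
        intro z hz
        have hz' := hz.2
        simp only [hcap, mem_setOf_eq, not_forall, not_le] at hz'
        obtain ⟨r, hr, i, hi⟩ := hz'
        exact ⟨r, hr, i, hi⟩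

/-- The route is still decided after restatement (1): `closes` with the pre-shock form. -/
theorem closes_preShock : MaxSpeedBoundLogPreShock → CappedEulerLimit → _root_.HydrodynamicLimit := by
  intro hMS hU
  obtain ⟨η₀, hη₀, hU⟩ := hU
  refine ⟨η₀, hη₀, ?_⟩
  intro a₀ θ₀ u₀ ha hθ hu ha0 hθ0
  obtain ⟨σ₁, hσ₁, h1⟩ := hMS a₀ θ₀ u₀ ha hθ hu ha0 hθ0
  obtain ⟨σ₂, hσ₂, h2⟩ := hU a₀ θ₀ u₀ ha hθ hu ha0 hθ0
  refine ⟨min σ₁ σ₂, lt_min hσ₁ hσ₂, ?_⟩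
  intro σ hσ hσlt T ρ θ u hsol hpack Φ h0 t ht
  obtain ⟨C, hC⟩ := h1 σ hσ (lt_of_lt_of_le hσlt (min_le_left _ _)) T ρ θ u hsol Φ h0 t ht
  have hUC := h2 σ hσ (lt_of_lt_of_le hσlt (min_le_right _ _)) T ρ θ u hsol hpack Φ h0 t ht C
  intro χ hχ δ hδ
  obtain ⟨hU1, hU2, hU3⟩ := hUC χ hχ δ hδ
  exact ⟨tendsto_of_tendsto_restrict_cap hC _ hU1, tendsto_of_tendsto_restrict_cap hC _ hU2,
    tendsto_of_tendsto_restrict_cap hC _ hU3⟩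

/-- The route is still decided after restatement (2): `closes` with the GUARDED pre-shock form
(packing threshold of the conjunct := `min` of the two thresholds). -/
theorem closes_preShockGuarded :
    MaxSpeedBoundLogPreShockGuarded → CappedEulerLimit → _root_.HydrodynamicLimit := by
  intro hMS hU
  obtain ⟨η₁, hη₁, hMS⟩ := hMS
  obtain ⟨η₂, hη₂, hU⟩ := hU
  refine ⟨min η₁ η₂, lt_min hη₁ hη₂, ?_⟩
  intro a₀ θ₀ u₀ ha hθ hu ha0 hθ0
  obtain ⟨σ₁, hσ₁, h1⟩ := hMS a₀ θ₀ u₀ ha hθ hu ha0 hθ0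
  obtain ⟨σ₂, hσ₂, h2⟩ := hU a₀ θ₀ u₀ ha hθ hu ha0 hθ0
  refine ⟨min σ₁ σ₂, lt_min hσ₁ hσ₂, ?_⟩
  intro σ hσ hσlt T ρ θ u hsol hpack Φ h0 t ht
  have hpack1 : ∀ s ∈ Ico 0 T, ∀ x, ρ s x * σ ^ 3 < η₁ :=
    fun s hs x => lt_of_lt_of_le (hpack s hs x) (min_le_left _ _)
  have hpack2 : ∀ s ∈ Ico 0 T, ∀ x, ρ s x * σ ^ 3 < η₂ :=
    fun s hs x => lt_of_lt_of_le (hpack s hs x) (min_le_right _ _)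
  obtain ⟨C, hC⟩ := h1 σ hσ (lt_of_lt_of_le hσlt (min_le_left _ _)) T ρ θ u hsol hpack1 Φ h0 t ht
  have hUC := h2 σ hσ (lt_of_lt_of_le hσlt (min_le_right _ _)) T ρ θ u hsol hpack2 Φ h0 t ht C
  intro χ hχ δ hδ
  obtain ⟨hU1, hU2, hU3⟩ := hUC χ hχ δ hδ
  exact ⟨tendsto_of_tendsto_restrict_cap hC _ hU1, tendsto_of_tendsto_restrict_cap hC _ hU2,
    tendsto_of_tendsto_restrict_cap hC _ hU3⟩

/-! ## The line transfers: the restated dynamic stub and the composition -/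

/-- RESTATED STUB 3 (pre-shock): the registered `stub_energeticCollisionsRare` with the pre-shock
prefix — along a classical hard-sphere Euler solution on `[0,T)` matched at `t = 0`, for
`t ∈ Ico 0 T`, there are `C ≥ 0` and measurable majorants `g N` of the number of collision times
in `(0,t]` whose colliding pair has kinetic energy `> C² log(N+2)`, on good orbits, with
`∫⁻ g N d(localGibbsLaw) → 0`. (Here `θ` is a priori bounded on `[0,t] × 𝕋³`, `t < T`, so the
physical level `C² > (8/3) sup θ` is meaningful; the `∀ t ≥ 0` surplus hit by focusing is gone.) -/
def EnergeticCollisionsRarePreShock : Prop :=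
  ∀ (a₀ θ₀ : T3 → ℝ) (u₀ : T3 → V3), Continuous a₀ → Continuous θ₀ → Continuous u₀ →
    (∀ x, 0 < a₀ x) → (∀ x, 0 < θ₀ x) →
    ∃ σ₀ : ℝ, 0 < σ₀ ∧ ∀ σ : ℝ, 0 < σ → σ < σ₀ →
      ∀ (T : ℝ) (ρ θ : ℝ → T3 → ℝ) (u : ℝ → T3 → V3), IsHardSphereEulerSolution σ T ρ u θ →
        ∀ Φ : (N : ℕ) → HardSphereFlow (Torus.geometry (Fin 3)) (hsDiameter σ N) (N + 1),
          TendstoHydroFieldsAt (fun N => localGibbsLaw σ a₀ u₀ θ₀ N (Φ N)) Φ ρ u θ 0 →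
            ∀ t ∈ Ico 0 T, ∃ C : ℝ, 0 ≤ C ∧
              ∃ g : (N : ℕ) → Config (N + 1) (Fin 3) T3 → ℝ≥0∞, (∀ N, Measurable (g N)) ∧
                (∀ N, ∀ z ∈ (Φ N).good,
                  ((Set.ncard {r ∈ Set.Ioc 0 t | ∃ i j : Fin (N + 1), i ≠ j ∧
                      (Φ N).flow r z ∈ contactSet (Torus.geometry (Fin 3)) (N + 1) (hsDiameter σ N) i j ∧
                      (C * Real.sqrt (Real.log ((N : ℝ) + 2))) ^ 2 <
                        ‖((Φ N).flow r z i).2‖ ^ 2 + ‖((Φ N).flow r z j).2‖ ^ 2} : ℕ) : ℝ≥0∞) ≤ g N z) ∧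
                Tendsto (fun N : ℕ => ∫⁻ z, g N z ∂(localGibbsLaw σ a₀ u₀ θ₀ N (Φ N))) atTop (𝓝 0)

/-- RESTATED STUB 3 (pre-shock, packing-guarded): as `EnergeticCollisionsRarePreShock` with the
conjunct's packing guard (`∃ η₀ > 0` outermost). -/
def EnergeticCollisionsRarePreShockGuarded : Prop :=
  ∃ η₀ : ℝ, 0 < η₀ ∧ ∀ (a₀ θ₀ : T3 → ℝ) (u₀ : T3 → V3), Continuous a₀ → Continuous θ₀ → Continuous u₀ →
    (∀ x, 0 < a₀ x) → (∀ x, 0 < θ₀ x) →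
    ∃ σ₀ : ℝ, 0 < σ₀ ∧ ∀ σ : ℝ, 0 < σ → σ < σ₀ →
      ∀ (T : ℝ) (ρ θ : ℝ → T3 → ℝ) (u : ℝ → T3 → V3), IsHardSphereEulerSolution σ T ρ u θ →
        (∀ t ∈ Ico 0 T, ∀ x, ρ t x * σ ^ 3 < η₀) →
        ∀ Φ : (N : ℕ) → HardSphereFlow (Torus.geometry (Fin 3)) (hsDiameter σ N) (N + 1),
          TendstoHydroFieldsAt (fun N => localGibbsLaw σ a₀ u₀ θ₀ N (Φ N)) Φ ρ u θ 0 →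
            ∀ t ∈ Ico 0 T, ∃ C : ℝ, 0 ≤ C ∧
              ∃ g : (N : ℕ) → Config (N + 1) (Fin 3) T3 → ℝ≥0∞, (∀ N, Measurable (g N)) ∧
                (∀ N, ∀ z ∈ (Φ N).good,
                  ((Set.ncard {r ∈ Set.Ioc 0 t | ∃ i j : Fin (N + 1), i ≠ j ∧
                      (Φ N).flow r z ∈ contactSet (Torus.geometry (Fin 3)) (N + 1) (hsDiameter σ N) i j ∧
                      (C * Real.sqrt (Real.log ((N : ℝ) + 2))) ^ 2 <
                        ‖((Φ N).flow r z i).2‖ ^ 2 + ‖((Φ N).flow r z j).2‖ ^ 2} : ℕ) : ℝ≥0∞) ≤ g N z) ∧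
                Tendsto (fun N : ℕ => ∫⁻ z, g N z ∂(localGibbsLaw σ a₀ u₀ θ₀ N (Φ N))) atTop (𝓝 0)

/-- The restated stub is implied by the registered one (so cycle 1's conditional proof of stub 3
from `GaussianVelocityTails ∧ ContactIntensityDominationOneRare`, p149442, carries over). -/
theorem energeticCollisionsRarePreShock_of_allTime
    (hRare : ∀ (a₀ θ₀ : T3 → ℝ) (u₀ : T3 → V3), Continuous a₀ → Continuous θ₀ → Continuous u₀ →
      (∀ x, 0 < a₀ x) → (∀ x, 0 < θ₀ x) →
      ∃ σ₀ : ℝ, 0 < σ₀ ∧ ∀ σ : ℝ, 0 < σ → σ < σ₀ → ∀ t : ℝ, 0 ≤ t →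
        ∀ Φ : (N : ℕ) → HardSphereFlow (Torus.geometry (Fin 3)) (hsDiameter σ N) (N + 1),
          ∃ C : ℝ, 0 ≤ C ∧
            ∃ g : (N : ℕ) → Config (N + 1) (Fin 3) T3 → ℝ≥0∞, (∀ N, Measurable (g N)) ∧
              (∀ N, ∀ z ∈ (Φ N).good,
                ((Set.ncard {r ∈ Set.Ioc 0 t | ∃ i j : Fin (N + 1), i ≠ j ∧
                    (Φ N).flow r z ∈ contactSet (Torus.geometry (Fin 3)) (N + 1) (hsDiameter σ N) i j ∧
                    (C * Real.sqrt (Real.log ((N : ℝ) + 2))) ^ 2 <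
                      ‖((Φ N).flow r z i).2‖ ^ 2 + ‖((Φ N).flow r z j).2‖ ^ 2} : ℕ) : ℝ≥0∞) ≤ g N z) ∧
              Tendsto (fun N : ℕ => ∫⁻ z, g N z ∂(localGibbsLaw σ a₀ u₀ θ₀ N (Φ N))) atTop (𝓝 0)) :
    EnergeticCollisionsRarePreShock := by
  intro a₀ θ₀ u₀ ha hθ hu ha0 hθ0
  obtain ⟨σ₀, hσ₀, H⟩ := hRare a₀ θ₀ u₀ ha hθ hu ha0 hθ0
  exact ⟨σ₀, hσ₀, fun σ hσ hσ' T ρ θ u _ Φ _ t ht => H σ hσ hσ' t ht.1 Φ⟩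

/-- The guarded restated stub is implied by the unguarded one. -/
theorem energeticCollisionsRarePreShockGuarded_of_preShock (h : EnergeticCollisionsRarePreShock) :
    EnergeticCollisionsRarePreShockGuarded := by
  refine ⟨1, one_pos, fun a₀ θ₀ u₀ ha hθ hu ha0 hθ0 => ?_⟩
  obtain ⟨σ₀, hσ₀, H⟩ := h a₀ θ₀ u₀ ha hθ hu ha0 hθ0
  exact ⟨σ₀, hσ₀, fun σ hσ hσ' T ρ θ u hsol _ Φ h0 t ht => H σ hσ hσ' T ρ θ u hsol Φ h0 t ht⟩

/-- **THE LINE TRANSFERS (1)**: the restated crux from the restated dynamic stub, through the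
LANDED static tail (`stub_initialSpeedTailLog`, p148064), the LANDED pathwise record lemma
(`stub_energeticCollisionRecord`, p147642) and the LANDED composition `exists_speedCap_of`
(p149684) — i.e. the registered skeleton with the pre-shock prefix threaded through. -/
theorem MaxSpeedBoundLogPreShock_of (hRare : EnergeticCollisionsRarePreShock) :
    MaxSpeedBoundLogPreShock := by
  intro a₀ θ₀ u₀ ha hθ hu ha0 hθ0
  obtain ⟨σ₀, hσ₀, H⟩ := hRare a₀ θ₀ u₀ ha hθ hu ha0 hθ0
  refine ⟨σ₀, hσ₀, fun σ hσ hσlt T ρ θ u hsol Φ h0 t ht => ?_⟩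
  exact exists_speedCap_of
    (Summit.AtomisticToContinuum.HydrodynamicLimit.Cruxes.MaxSpeedBoundLog.Birth.stub_initialSpeedTailLog
      a₀ θ₀ u₀ ha hθ hu ha0 hθ0 σ hσ Φ)
    (fun N z hz c =>
      Summit.AtomisticToContinuum.HydrodynamicLimit.Theorems.MaxSpeedBoundLogBirth.stub_energeticCollisionRecord
        σ N (Φ N) z hz c t)
    (H σ hσ hσlt T ρ θ u hsol Φ h0 t ht)

/-- **THE LINE TRANSFERS (2)**: the guarded restated crux from the guarded restated dynamic stub
(same three landed pieces). -/
theorem MaxSpeedBoundLogPreShockGuarded_of (hRare : EnergeticCollisionsRarePreShockGuarded) :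
    MaxSpeedBoundLogPreShockGuarded := by
  obtain ⟨η₀, hη₀, hRare⟩ := hRare
  refine ⟨η₀, hη₀, fun a₀ θ₀ u₀ ha hθ hu ha0 hθ0 => ?_⟩
  obtain ⟨σ₀, hσ₀, H⟩ := hRare a₀ θ₀ u₀ ha hθ hu ha0 hθ0
  refine ⟨σ₀, hσ₀, fun σ hσ hσlt T ρ θ u hsol hpack Φ h0 t ht => ?_⟩
  exact exists_speedCap_of
    (Summit.AtomisticToContinuum.HydrodynamicLimit.Cruxes.MaxSpeedBoundLog.Birth.stub_initialSpeedTailLog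
      a₀ θ₀ u₀ ha hθ hu ha0 hθ0 σ hσ Φ)
    (fun N z hz c =>
      Summit.AtomisticToContinuum.HydrodynamicLimit.Theorems.MaxSpeedBoundLogBirth.stub_energeticCollisionRecord
        σ N (Φ N) z hz c t)
    (H σ hσ hσlt T ρ θ u hsol hpack Φ h0 t ht)

/-! ## After the cycle-2 reshape: the restated open stub 3b and its composition -/

/-- RESTATED STUB 3b (pre-shock, packing-guarded): the registered open stub
`stub_energeticWindowBound` with the pre-shock guarded prefix — along a classical hard-sphere
Euler solution on `[0,T)` obeying the packing guard and matched at `t = 0`, for `t ∈ Ioo 0 T`,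
there are `C ≥ 0`, tube families `S N M` with the covering property at window length `t/M` and
`B N → 0` bounding the time-Riemann sums of the fixed-time local-Gibbs means of the one-window
energetic pair functionals at level `C √log(N+2)`. This is the honest open-problem stub of the
restated line (plausibly TRUE: `θ` is a priori bounded on `[0,t] × 𝕋³`). -/
def EnergeticWindowBoundPreShockGuarded : Prop :=
  ∃ η₀ : ℝ, 0 < η₀ ∧ ∀ (a₀ θ₀ : T3 → ℝ) (u₀ : T3 → V3), Continuous a₀ → Continuous θ₀ → Continuous u₀ →
    (∀ x, 0 < a₀ x) → (∀ x, 0 < θ₀ x) →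
    ∃ σ₀ : ℝ, 0 < σ₀ ∧ ∀ σ : ℝ, 0 < σ → σ < σ₀ →
      ∀ (T : ℝ) (ρ θ : ℝ → T3 → ℝ) (u : ℝ → T3 → V3), IsHardSphereEulerSolution σ T ρ u θ →
        (∀ t ∈ Ico 0 T, ∀ x, ρ t x * σ ^ 3 < η₀) →
        ∀ Φ : (N : ℕ) → HardSphereFlow (Torus.geometry (Fin 3)) (hsDiameter σ N) (N + 1),
          TendstoHydroFieldsAt (fun N => localGibbsLaw σ a₀ u₀ θ₀ N (Φ N)) Φ ρ u θ 0 →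
            ∀ t ∈ Ioo 0 T, ∃ C : ℝ, 0 ≤ C ∧
              ∃ S : ℕ → ℕ → V3 → Set V3,
                (∀ N M, MeasurableSet {q : V3 × V3 | q.1 ∈ S N M q.2}) ∧
                (∀ (N M : ℕ) (u r : V3) (s : ℝ), hsDiameter σ N ≤ ‖r‖ → s ∈ Set.Icc 0 (t / M) →
                  ‖r + s • u‖ = hsDiameter σ N → r ∈ S N M u) ∧
              ∃ B : ℕ → ℝ≥0∞, Tendsto B atTop (𝓝 0) ∧
                ∀ N : ℕ, liminf (fun M : ℕ => ∑ k ∈ Finset.Icc 1 M,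
                  ∫⁻ z, (∑ i : Fin (N + 1), ∑ j : Fin (N + 1), (if i ≠ j then
                    {w : Config (N + 1) (Fin 3) T3 | ∃ k : Fin 3 → ℤ,
                        Torus.reprSym ((w i).1 - (w j).1) + Torus.latticeVec k ∈ S N M ((w j).2 - (w i).2)}.indicator
                      (fun w => Set.indicator {p : V3 × V3 |
                          (C * Real.sqrt (Real.log ((N : ℝ) + 2))) ^ 2 < ‖p.1‖ ^ 2 + ‖p.2‖ ^ 2}
                        (fun _ => (1 : ℝ≥0∞)) ((w i).2, (w j).2))
                      ((Φ N).flow ((k : ℝ) * (t / M)) z) else 0))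
                    ∂(localGibbsLaw σ a₀ u₀ θ₀ N (Φ N))) atTop ≤ B N

/-- Nothing is lost at stub level: the registered (all `t > 0`) stub 3b implies its pre-shock
guarded restatement. -/
theorem energeticWindowBoundPreShockGuarded_of_allTime
    (h3b : ∀ (a₀ θ₀ : T3 → ℝ) (u₀ : T3 → V3), Continuous a₀ → Continuous θ₀ → Continuous u₀ →
      (∀ x, 0 < a₀ x) → (∀ x, 0 < θ₀ x) →
      ∃ σ₀ : ℝ, 0 < σ₀ ∧ ∀ σ : ℝ, 0 < σ → σ < σ₀ → ∀ t : ℝ, 0 < t →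
      ∀ Φ : (N : ℕ) → HardSphereFlow (Torus.geometry (Fin 3)) (hsDiameter σ N) (N + 1),
      ∃ C : ℝ, 0 ≤ C ∧
      ∃ S : ℕ → ℕ → V3 → Set V3,
        (∀ N M, MeasurableSet {q : V3 × V3 | q.1 ∈ S N M q.2}) ∧
        (∀ (N M : ℕ) (u r : V3) (s : ℝ), hsDiameter σ N ≤ ‖r‖ → s ∈ Set.Icc 0 (t / M) →
          ‖r + s • u‖ = hsDiameter σ N → r ∈ S N M u) ∧
      ∃ B : ℕ → ℝ≥0∞, Tendsto B atTop (𝓝 0) ∧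
        ∀ N : ℕ, liminf (fun M : ℕ => ∑ k ∈ Finset.Icc 1 M,
          ∫⁻ z, (∑ i : Fin (N + 1), ∑ j : Fin (N + 1), (if i ≠ j then
            {w : Config (N + 1) (Fin 3) T3 | ∃ k : Fin 3 → ℤ,
                Torus.reprSym ((w i).1 - (w j).1) + Torus.latticeVec k ∈ S N M ((w j).2 - (w i).2)}.indicator
              (fun w => Set.indicator {p : V3 × V3 |
                  (C * Real.sqrt (Real.log ((N : ℝ) + 2))) ^ 2 < ‖p.1‖ ^ 2 + ‖p.2‖ ^ 2}
                (fun _ => (1 : ℝ≥0∞)) ((w i).2, (w j).2))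
              ((Φ N).flow ((k : ℝ) * (t / M)) z) else 0))
            ∂(localGibbsLaw σ a₀ u₀ θ₀ N (Φ N))) atTop ≤ B N) :
    EnergeticWindowBoundPreShockGuarded := by
  refine ⟨1, one_pos, fun a₀ θ₀ u₀ ha hθ hu ha0 hθ0 => ?_⟩
  obtain ⟨σ₀, hσ₀, H⟩ := h3b a₀ θ₀ u₀ ha hθ hu ha0 hθ0
  exact ⟨σ₀, hσ₀, fun σ hσ hσ' T ρ θ u _ _ Φ _ t ht => H σ hσ hσ' t ht.1 Φ⟩

/-- **THE RESHAPED LINE TRANSFERS (stub level)**: the restated stub 3 from the restated open stub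
3b through the LANDED reduction 3a (`stub_energeticCollisionsRare_of_windowBound`, p155909):
`σ₀ := min σ₀(3b′) (1/2)`; `t = 0` is the empty window; `t > 0` is 3a fed with 3b′. -/
theorem energeticCollisionsRarePreShockGuarded_of_window (h3b : EnergeticWindowBoundPreShockGuarded) :
    EnergeticCollisionsRarePreShockGuarded := by
  obtain ⟨η₀, hη₀, h3b⟩ := h3b
  refine ⟨η₀, hη₀, fun a₀ θ₀ u₀ ha hθ hu ha0 hθ0 => ?_⟩
  obtain ⟨σ₀, hσ₀, H⟩ := h3b a₀ θ₀ u₀ ha hθ hu ha0 hθ0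
  refine ⟨min σ₀ (1 / 2), lt_min hσ₀ (by norm_num), fun σ hσ hσlt T ρ θ u hsol hpack Φ h0 t ht => ?_⟩
  have hσ₀' : σ < σ₀ := lt_of_lt_of_le hσlt (min_le_left _ _)
  have hσ2 : σ < 1 / 2 := lt_of_lt_of_le hσlt (min_le_right _ _)
  rcases ht.1.eq_or_lt with hzero | htpos
  · -- the window `(0, 0]` is empty: nothing to count
    subst hzero
    refine ⟨0, le_rfl, fun _ _ => 0, fun _ => measurable_const, fun N z _ => ?_, ?_⟩
    swap
    · simpa only [MeasureTheory.lintegral_zero] using tendsto_const_nhds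
    have hempty : {r ∈ Set.Ioc (0 : ℝ) 0 | ∃ i j : Fin (N + 1), i ≠ j ∧
        (Φ N).flow r z ∈ contactSet (Torus.geometry (Fin 3)) (N + 1) (hsDiameter σ N) i j ∧
        (0 * Real.sqrt (Real.log ((N : ℝ) + 2))) ^ 2 <
          ‖((Φ N).flow r z i).2‖ ^ 2 + ‖((Φ N).flow r z j).2‖ ^ 2} = ∅ := by
      ext r
      simp only [Set.Ioc_self, Set.mem_empty_iff_false, false_and, Set.mem_setOf_eq]
    rw [hempty, Set.ncard_empty]
    simp
  · obtain ⟨C, hC, S, hSm, hS, B, hB, hwin⟩ := H σ hσ hσ₀' T ρ θ u hsol hpack Φ h0 t ⟨htpos, ht.2⟩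
    exact Summit.AtomisticToContinuum.HydrodynamicLimit.Theorems.MaxSpeedBoundLogLine.stub_energeticCollisionsRare_of_windowBound
      σ hσ hσ2 a₀ θ₀ u₀ t htpos Φ C hC S hSm hS B hB hwin

/-- **THE RESHAPED LINE TRANSFERS (crux level)**: the guarded restated crux from the restated
open stub 3b alone — every other piece (stubs 1, 2, 3a, the composition) is LANDED. This is the
skeleton the planner can register verbatim after `route edit --restate MaxSpeedBoundLog`. -/
theorem MaxSpeedBoundLogPreShockGuarded_of_window (h3b : EnergeticWindowBoundPreShockGuarded) :
    MaxSpeedBoundLogPreShockGuarded :=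
  MaxSpeedBoundLogPreShockGuarded_of (energeticCollisionsRarePreShockGuarded_of_window h3b)

end Summit.AtomisticToContinuum.HydrodynamicLimit.Cruxes.MaxSpeedBoundLog.BirthPreShock
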